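import Summits.QuantumFields.BalabanUV.Beta.GAN24.E3UnitSplitSum
import Literature.MathematicalPhysics.QuantumFieldTheory.Balaban1983to89.Beta.DecLiftAdjoint
import Summits.QuantumFields.BalabanUV.Beta.SymAveragingHessianCounts

/-!
# The (V-H) statements of `E3UnitSplitLevels` RE-RUN FOR THE UN-NEGATED LIFT of an1's SYMMETRISED border `symVhSAt ρ` (twin of `E3UnitSplitLevelsVSymAt`): block lemmas and the three V unit-split templates

NOT IN PRINT — OUR BOOKKEEPING (road-P2 = `b2b-balaban-gan24-p2` gen 56, 2026-08-25; row G-an2-4 ∕ (CONV-C), the (α-0) chain at row D1's literal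
OF RECORD (III′) `JsB12CombShSym`; [folklore] composition BY NAME; 0 `def`, 0 cite, 0 `def … : Prop`, 0 `sorry`).  Weight 0.  NEVER «G-an2-4 closed» as (CONV-C);
NOT D1, NOT BetaPertH, NOT continuum, NOT Clay; NO campaign opened (an2 W-4) — a brick of the located `hUv⁰` transfer (road-P2 MEMO M-gan24p2-g56-1 §2(b) with M.77's
RAW-table socket `CombBornBorderLettersRaw`).

NAMING: in this package «Sym» in the ROOTED file names (`…SymAt`) means the UN-NEGATED rooted border `vhSAt ρ` (the OWNER's W15), while «An1» (these files) means an1's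
(0.4)-SYMMETRISED border table `SymAveragingHessianCounts.symVhSAt ρ` — the type of the record field `SymTables.V`.  METHOD = the OWNER gan24-p1's gen-6 `mkroot.py` rule
(road-P2's `tools/mkstab.py`): the ROOTED file VERBATIM with `vhSAt (toSite r) ↦ symVhSAt (toSite r)`, asym's `SpineRooted.borderIncAt ↦ TaylorMassVHAn1At.symBorderIncAt`, an1's
rooted support ∕ entry ∕ locality lemmas ↦ his SYMMETRISED ones (`symVhKerAt_eq_zero_left ∕ _right`, `abs_symVhKerAt_le ≤ 3ℓ²` «the SAME constant as the comb's», `locStencil_symVhSAt`,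
block accessors by `packVH`); every ROOT-FREE lemma of the base modules BY NAME (not re-declared); same theorem names in the `…An1At` namespaces; base and rooted modules untouched;
zero-root bridges dropped (no root-0 base twin for the sym table).  Discharges NOTHING of (hS, hSall) ∕ hB by itself.
-/

noncomputable section

open Finset
open scoped BigOperators
open Literature.MathematicalPhysics.QuantumFieldTheory
open Literature.MathematicalPhysics.QuantumFieldTheory.Balaban1983to89
open Literature.MathematicalPhysics.QuantumFieldTheory.Balaban1983to89.Beta
open ExpKernelCalculus (MKer)
open KernelSpecInstance (wH wΦ)
open KKTFluctuationKernel (GamΦ)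
open OneStepResolventKernel (Fib KInv)
open InterLevelTransport (avgLift)
open AveragingHessianKernels (vhS packVH_inl_inl packVH_inr_inr)
open Summit.QuantumFields.BalabanUV.Beta.SymAveragingHessianCounts (symVhSAt symVhKerAt symVhKerAt_eq_zero_left symVhKerAt_eq_zero_right abs_symVhKerAt_le
  locStencil_symVhSAt symVhSAt_symm)
open BalabanCompositeJets (pushSum pushSum_inl_inl borderInc)
open DecLiftAdjoint (borderSum)
open Summit.QuantumFields.BalabanUV.Beta.GAN24.E3UnitSplit (e3OfS pushSum_block_zero avgLift_block_zero e3VH_unit_split_of)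

namespace Summit.QuantumFields.BalabanUV.Beta.GAN24.E3UnitSplitLevelsVSymAn1At

variable {d : ℕ}

/-! ## §1 The rooted (V-H) pieces are off-diagonal -/

section Blocks

variable {Lc : ℕ}

/-- [folklore] The rooted (V-H) table has no field–field block (an1's `packVH`, any root; `StencilSlotVHRoot.symVhSAt_inl_inl` restated to keep imports light). -/
theorem vhSAt_ff (ρ : Fin (d + 1) → ℤ) (κ : Fin (d + 1)) (u x z : Fin (d + 1) → ℤ) (α β : Fin (d + 1)) :
    symVhSAt ρ d Lc rfl κ u x z (Sum.inl α) (Sum.inl β) = 0 := rfl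

/-- [folklore] … and no multiplier–multiplier block. -/
theorem vhSAt_mm (ρ : Fin (d + 1) → ℤ) (κ : Fin (d + 1)) (u x z : Fin (d + 1) → ℤ) (μ ν : Fin (d + 1)) :
    symVhSAt ρ d Lc rfl κ u x z (Sum.inr μ) (Sum.inr ν) = 0 := rfl

/-- [folklore] **THE ROOTED BORDER INCREMENT IS OFF-DIAGONAL**: no field–field block … -/
theorem borderSumV_inl_inl (ρ : Fin (d + 1) → ℤ) {M : ℕ} (κ : Fin (d + 1)) (u x z : Fin (d + 1) → ℤ) (α β : Fin (d + 1)) :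
    borderSum M (fun κ₀ z₀ => symVhSAt ρ d Lc rfl κ₀ z₀) κ u x z (Sum.inl α) (Sum.inl β) = 0 := by
  simp only [borderSum]
  exact Finset.sum_eq_zero fun s _ => avgLift_block_zero _ _ _ (fun x z => vhSAt_ff ρ κ _ x z α β) x z

/-- [folklore] … and no multiplier–multiplier block. -/
theorem borderSumV_inr_inr (ρ : Fin (d + 1) → ℤ) {M : ℕ} (κ : Fin (d + 1)) (u x z : Fin (d + 1) → ℤ) (μ ν : Fin (d + 1)) :
    borderSum M (fun κ₀ z₀ => symVhSAt ρ d Lc rfl κ₀ z₀) κ u x z (Sum.inr μ) (Sum.inr ν) = 0 := by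
  simp only [borderSum]
  exact Finset.sum_eq_zero fun s _ => avgLift_block_zero _ _ _ (fun x z => vhSAt_mm ρ κ _ x z μ ν) x z

/-- [folklore] A pushed rooted `S₀` (V-H) stencil is off-diagonal (ff). -/
theorem pushSum_vhSAt_ff (ρ : Fin (d + 1) → ℤ) {M L : ℕ} (κ : Fin (d + 1)) (u x z : Fin (d + 1) → ℤ) (α β : Fin (d + 1)) :
    pushSum M L (symVhSAt ρ d Lc rfl κ u) x z (Sum.inl α) (Sum.inl β) = 0 := by
  rw [pushSum_inl_inl, vhSAt_ff]

/-- [folklore] A pushed rooted `S₀` (V-H) stencil is off-diagonal (mm). -/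
theorem pushSum_vhSAt_mm (ρ : Fin (d + 1) → ℤ) {M L : ℕ} (κ : Fin (d + 1)) (u x z : Fin (d + 1) → ℤ) (μ ν : Fin (d + 1)) :
    pushSum M L (symVhSAt ρ d Lc rfl κ u) x z (Sum.inr μ) (Sum.inr ν) = 0 :=
  pushSum_block_zero _ _ _ (fun x z => vhSAt_mm ρ κ u x z μ ν) x z

/-- [folklore] A pushed rooted border increment is off-diagonal (ff). -/
theorem pushSum_borderSumV_inl_inl (ρ : Fin (d + 1) → ℤ) {M L M' : ℕ} (κ : Fin (d + 1)) (u x z : Fin (d + 1) → ℤ) (α β : Fin (d + 1)) :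
    pushSum M L (borderSum M' (fun κ₀ z₀ => symVhSAt ρ d Lc rfl κ₀ z₀) κ u) x z (Sum.inl α) (Sum.inl β) = 0 := by
  rw [pushSum_inl_inl, borderSumV_inl_inl]

/-- [folklore] A pushed rooted border increment is off-diagonal (mm). -/
theorem pushSum_borderSumV_inr_inr (ρ : Fin (d + 1) → ℤ) {M L M' : ℕ} (κ : Fin (d + 1)) (u x z : Fin (d + 1) → ℤ) (μ ν : Fin (d + 1)) :
    pushSum M L (borderSum M' (fun κ₀ z₀ => symVhSAt ρ d Lc rfl κ₀ z₀) κ u) x z (Sum.inr μ) (Sum.inr ν) = 0 :=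
  pushSum_block_zero _ _ _ (fun x z => borderSumV_inr_inr ρ κ u x z μ ν) x z

end Blocks

/-! ## §2 The three rooted (V-H) templates -/

section Levels

variable {Lc : ℕ} [NeZero Lc]

/-- [folklore] **THE ROOTED (V-H) TEMPLATE, LEVEL `ℓ ≥ 1`, PUSHED `k` TIMES** (any root `ρ`): `P = pushSum (Lc^{ℓ+1}) (Lc^k) (borderSum (Lc^ℓ) (vhSAt ρ …) κ u)` (SYMMETRIC table) in leaf-01's
`e3VH_unit_split_of` — the base `e3VH_unit_split` symbol for symbol with the rooted increment. -/
theorem e3VH_unit_split_at (ρ : Fin (d + 1) → ℤ) (cVH : ℝ) (ℓ k p : ℕ) (hp : p = ℓ + k + 1) (κ' : Fin (d + 1)) (u' x' z' : Fin (d + 1) → ℤ) (α β : Fin (d + 1)) :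
    ((Lc : ℝ) ^ p) ^ (2 * (d + 1)) *
        e3OfS (Lc ^ p) (fun κ u => (((Lc : ℝ) ^ (d + 1)) ^ k * (cVH * ((Lc : ℝ) ^ ℓ) ^ (d + 2))) • pushSum (Lc ^ (ℓ + 1)) (Lc ^ k) (borderSum (Lc ^ ℓ) (fun κ₀ z₀ => symVhSAt ρ d Lc rfl κ₀ z₀) κ u)) κ' u' x' z' (Sum.inl α) (Sum.inl β) =
      -(cVH / (Lc : ℝ) ^ (d + 1)) * ((Lc : ℝ) ^ p) ^ (-(2 : ℤ)) * (Lc : ℝ) ^ ℓ *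
        ∑' y : Fin (d + 1) → ℤ,
          ((∑ l' : Fin (d + 1),
            (∑' w : Fin (d + 1) → ℤ, ∑ l : Fin (d + 1),
                (((Lc : ℝ) ^ p) ^ (2 * (d + 1)) * KInv (N := Lc ^ p) (d := d) (((Lc ^ p : ℕ) : ℤ) • x') w (Sum.inr α) (Sum.inr l)) *
                ∑ κ'' : Fin (d + 1), (((Lc : ℝ) ^ p) ^ (d + 1))⁻¹ * ∑' u : Fin (d + 1) → ℤ,
                  (((Lc : ℝ) ^ p) ^ (d + 2) * wH (N := Lc ^ p) κ'' κ' (u - ((Lc ^ p : ℕ) : ℤ) • u')) *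
                    pushSum (Lc ^ (ℓ + 1)) (Lc ^ k) (borderSum (Lc ^ ℓ) (fun κ₀ z₀ => symVhSAt ρ d Lc rfl κ₀ z₀) κ'' u) w y (Sum.inr l) (Sum.inl l')) *
              (((Lc : ℝ) ^ p) ^ (d + 2) * wH (N := Lc ^ p) l' β (y - ((Lc ^ p : ℕ) : ℤ) • z'))) +
          ∑ l' : Fin (d + 1),
            (∑' w : Fin (d + 1) → ℤ, ∑ l : Fin (d + 1),
                (((Lc : ℝ) ^ p) ^ (d + 2) * GamΦ (N := Lc ^ p) α x' l w) *
                ∑ κ'' : Fin (d + 1), (((Lc : ℝ) ^ p) ^ (d + 1))⁻¹ * ∑' u : Fin (d + 1) → ℤ,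
                  (((Lc : ℝ) ^ p) ^ (d + 2) * wH (N := Lc ^ p) κ'' κ' (u - ((Lc ^ p : ℕ) : ℤ) • u')) *
                    pushSum (Lc ^ (ℓ + 1)) (Lc ^ k) (borderSum (Lc ^ ℓ) (fun κ₀ z₀ => symVhSAt ρ d Lc rfl κ₀ z₀) κ'' u) w y (Sum.inl l) (Sum.inr l')) *
              (((Lc : ℝ) ^ p) ^ (2 * (d + 1)) *
                KInv (N := Lc ^ p) (d := d) y (((Lc ^ p : ℕ) : ℤ) • z') (Sum.inr l') (Sum.inr β))) :=
  e3VH_unit_split_of (Lc := Lc) (fun κ u => pushSum (Lc ^ (ℓ + 1)) (Lc ^ k) (borderSum (Lc ^ ℓ) (fun κ₀ z₀ => symVhSAt ρ d Lc rfl κ₀ z₀) κ u))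
    (fun κ u x z α β => pushSum_borderSumV_inl_inl ρ κ u x z α β) (fun κ u x z μ ν => pushSum_borderSumV_inr_inr ρ κ u x z μ ν)
    cVH ℓ k p hp κ' u' x' z' α β

/-- [folklore] **THE ROOTED (V-H) TEMPLATE, TOP LEVEL** (`k = 0`: the unpushed rooted top border increment, natural weight `cVH·M^{d+2}`, member `p = ℓ+1`). -/
theorem e3VHTop_unit_split_at (ρ : Fin (d + 1) → ℤ) (cVH : ℝ) (ℓ p : ℕ) (hp : p = ℓ + 1) (κ' : Fin (d + 1)) (u' x' z' : Fin (d + 1) → ℤ) (α β : Fin (d + 1)) :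
    ((Lc : ℝ) ^ p) ^ (2 * (d + 1)) *
        e3OfS (Lc ^ p) (fun κ u => (cVH * ((Lc : ℝ) ^ ℓ) ^ (d + 2)) • borderSum (Lc ^ ℓ) (fun κ₀ z₀ => symVhSAt ρ d Lc rfl κ₀ z₀) κ u) κ' u' x' z' (Sum.inl α) (Sum.inl β) =
      -(cVH / (Lc : ℝ) ^ (d + 1)) * ((Lc : ℝ) ^ p) ^ (-(2 : ℤ)) * (Lc : ℝ) ^ ℓ *
        ∑' y : Fin (d + 1) → ℤ,
          ((∑ l' : Fin (d + 1),
            (∑' w : Fin (d + 1) → ℤ, ∑ l : Fin (d + 1),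
                (((Lc : ℝ) ^ p) ^ (2 * (d + 1)) * KInv (N := Lc ^ p) (d := d) (((Lc ^ p : ℕ) : ℤ) • x') w (Sum.inr α) (Sum.inr l)) *
                ∑ κ'' : Fin (d + 1), (((Lc : ℝ) ^ p) ^ (d + 1))⁻¹ * ∑' u : Fin (d + 1) → ℤ,
                  (((Lc : ℝ) ^ p) ^ (d + 2) * wH (N := Lc ^ p) κ'' κ' (u - ((Lc ^ p : ℕ) : ℤ) • u')) *
                    borderSum (Lc ^ ℓ) (fun κ₀ z₀ => symVhSAt ρ d Lc rfl κ₀ z₀) κ'' u w y (Sum.inr l) (Sum.inl l')) *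
              (((Lc : ℝ) ^ p) ^ (d + 2) * wH (N := Lc ^ p) l' β (y - ((Lc ^ p : ℕ) : ℤ) • z'))) +
          ∑ l' : Fin (d + 1),
            (∑' w : Fin (d + 1) → ℤ, ∑ l : Fin (d + 1),
                (((Lc : ℝ) ^ p) ^ (d + 2) * GamΦ (N := Lc ^ p) α x' l w) *
                ∑ κ'' : Fin (d + 1), (((Lc : ℝ) ^ p) ^ (d + 1))⁻¹ * ∑' u : Fin (d + 1) → ℤ,
                  (((Lc : ℝ) ^ p) ^ (d + 2) * wH (N := Lc ^ p) κ'' κ' (u - ((Lc ^ p : ℕ) : ℤ) • u')) *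
                    borderSum (Lc ^ ℓ) (fun κ₀ z₀ => symVhSAt ρ d Lc rfl κ₀ z₀) κ'' u w y (Sum.inl l) (Sum.inr l')) *
              (((Lc : ℝ) ^ p) ^ (2 * (d + 1)) *
                KInv (N := Lc ^ p) (d := d) y (((Lc ^ p : ℕ) : ℤ) • z') (Sum.inr l') (Sum.inr β))) := by
  simpa only [pow_zero, one_mul] using
    e3VH_unit_split_of (Lc := Lc) (fun κ u => borderSum (Lc ^ ℓ) (fun κ₀ z₀ => symVhSAt ρ d Lc rfl κ₀ z₀) κ u) (fun κ u x z α β => borderSumV_inl_inl ρ κ u x z α β)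
      (fun κ u x z μ ν => borderSumV_inr_inr ρ κ u x z μ ν) cVH ℓ 0 p (by simpa using hp) κ' u' x' z' α β

/-- [folklore] **THE ROOTED (V-H) TEMPLATE, LEVEL `0`, PUSHED `k` TIMES** (`S₀`'s rooted (V-H) stencil, natural weight `(Lc^{d+1})^k·cVH`, member `p = k+1`; `M = 1`):
`P = pushSum Lc (Lc^k) (symVhSAt ρ d Lc κ u)` — the base `E3UnitSplitSum.e3VH0_unit_split` symbol for symbol with an1's UN-NEGATED rooted table. -/
theorem e3VH0_unit_split_at (ρ : Fin (d + 1) → ℤ) (cVH : ℝ) (k p : ℕ) (hp : p = k + 1) (κ' : Fin (d + 1)) (u' x' z' : Fin (d + 1) → ℤ) (α β : Fin (d + 1)) :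
    ((Lc : ℝ) ^ p) ^ (2 * (d + 1)) *
        e3OfS (Lc ^ p) (fun κ u => (((Lc : ℝ) ^ (d + 1)) ^ k * cVH) • pushSum Lc (Lc ^ k) (symVhSAt ρ d Lc rfl κ u)) κ' u' x' z' (Sum.inl α) (Sum.inl β) =
      -(cVH / (Lc : ℝ) ^ (d + 1)) * ((Lc : ℝ) ^ p) ^ (-(2 : ℤ)) *
        ∑' y : Fin (d + 1) → ℤ,
          ((∑ l' : Fin (d + 1),
            (∑' w : Fin (d + 1) → ℤ, ∑ l : Fin (d + 1),
                (((Lc : ℝ) ^ p) ^ (2 * (d + 1)) * KInv (N := Lc ^ p) (d := d) (((Lc ^ p : ℕ) : ℤ) • x') w (Sum.inr α) (Sum.inr l)) *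
                ∑ κ'' : Fin (d + 1), (((Lc : ℝ) ^ p) ^ (d + 1))⁻¹ * ∑' u : Fin (d + 1) → ℤ,
                  (((Lc : ℝ) ^ p) ^ (d + 2) * wH (N := Lc ^ p) κ'' κ' (u - ((Lc ^ p : ℕ) : ℤ) • u')) *
                    pushSum Lc (Lc ^ k) (symVhSAt ρ d Lc rfl κ'' u) w y (Sum.inr l) (Sum.inl l')) *
              (((Lc : ℝ) ^ p) ^ (d + 2) * wH (N := Lc ^ p) l' β (y - ((Lc ^ p : ℕ) : ℤ) • z'))) +
          ∑ l' : Fin (d + 1),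
            (∑' w : Fin (d + 1) → ℤ, ∑ l : Fin (d + 1),
                (((Lc : ℝ) ^ p) ^ (d + 2) * GamΦ (N := Lc ^ p) α x' l w) *
                ∑ κ'' : Fin (d + 1), (((Lc : ℝ) ^ p) ^ (d + 1))⁻¹ * ∑' u : Fin (d + 1) → ℤ,
                  (((Lc : ℝ) ^ p) ^ (d + 2) * wH (N := Lc ^ p) κ'' κ' (u - ((Lc ^ p : ℕ) : ℤ) • u')) *
                    pushSum Lc (Lc ^ k) (symVhSAt ρ d Lc rfl κ'' u) w y (Sum.inl l) (Sum.inr l')) *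
              (((Lc : ℝ) ^ p) ^ (2 * (d + 1)) *
                KInv (N := Lc ^ p) (d := d) y (((Lc ^ p : ℕ) : ℤ) • z') (Sum.inr l') (Sum.inr β))) := by
  simpa only [pow_zero, one_pow, mul_one] using
    e3VH_unit_split_of (Lc := Lc) (fun κ u => pushSum Lc (Lc ^ k) (symVhSAt ρ d Lc rfl κ u))
      (fun κ u x z α β => pushSum_vhSAt_ff ρ κ u x z α β) (fun κ u x z μ ν => pushSum_vhSAt_mm ρ κ u x z μ ν) cVH 0 k p (by simpa using hp)
      κ' u' x' z' α β

end Levels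

end Summit.QuantumFields.BalabanUV.Beta.GAN24.E3UnitSplitLevelsVSymAn1At

end
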